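import Mathlib
import Summits.Ventures.PercRepro.TriangleCapSpectrumExact
import Summits.Ventures.PercRepro.TriangleCapTopCherries

/-!
# PercRepro — THE FIRST `T` LAYERS IN THE REGIME `2 a + (T + 1) r ≤ k`, THE BIPARTITE CHERRY SPECTRUM, AND THE
CHERRY FORMS (p3, gen 51; part 234)

* `stabGapFull_ge_level`: `2 (T + 1)(r − T − 2) ≤ stabGapFull k a r` whenever `2 a + (T + 1) r ≤ k` — so
  (`cherry_top_layers_of_k`) in the regime `k ≥ 2 a + (T + 1) r` the first `T` layers of the cherry table are
  complete, for every `T` (the explicit `k`-regimes of parts 221–222 and 228 are the instances `T ≤ 5`).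
* `bipSub_gap_layers_level` / `bipSub_band_attained`: THE CHERRY SPECTRUM OF THE `a`-BIPARTITE CLASS — an
  `a`-bipartite graph with `a (k − a) − r` edges (`4 T + 3 ≤ r`) has its gap to the closed form at a band value
  `2 t (r − t − 1) + 2 j`, `t ≤ T`, or at least `2 (T + 1)(r − T − 2)`; and every band value is attained by an
  `a`-bipartite graph (no `K₄⁻`-free stability needed on this side).
* The cherry forms `cherry_band_full_cherries` and `cherry_top_layers_cherries` (`2·cherries` in place of `Σ d²`).
Axioms: standard.
-/

namespace PercRepro

namespace TriangleCap

namespace C047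

open Finset

/-- `(T + 1)(r − T − 2) ≤ (T + 1) r`, and `+ 2` still when `T + 3 ≤ r`. -/
theorem level_mul_le (T r : ℕ) :
    (T + 1) * (r - T - 2) ≤ (T + 1) * r ∧ (T + 3 ≤ r → (T + 1) * (r - T - 2) + 2 ≤ (T + 1) * r) := by
  refine ⟨Nat.mul_le_mul_left _ (by omega), fun h => ?_⟩
  obtain ⟨v, rfl⟩ : ∃ v, r = T + 3 + v := ⟨r - T - 3, by omega⟩
  have e : T + 3 + v - T - 2 = v + 1 := by omega
  rw [e]
  nlinarith

/-- **`stabGapFull k a r ≥ 2 (T + 1)(r − T − 2)` for `3 ≤ a`, `2 a + (T + 1) r ≤ k`.** -/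
theorem stabGapFull_ge_level (k a r T : ℕ) (ha3 : 3 ≤ a) (hk : 2 * a + (T + 1) * r ≤ k) :
    2 * ((T + 1) * (r - T - 2)) ≤ stabGapFull k a r := by
  obtain ⟨hQP, hQP2⟩ := level_mul_le T r
  have hQ : (T + 1) * (r - T - 2) + 1 ≤ (T + 1) * r ∨ (T + 1) * (r - T - 2) = 0 := by
    by_cases h : T + 3 ≤ r
    · left; have := hQP2 h; omega
    · right
      have : r - T - 2 = 0 := by omega
      rw [this, mul_zero]
  unfold stabGapFull
  by_cases h1 : r + 3 ≤ a
  · rw [if_pos h1]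
    have hb2 : 3 ≤ a - r := by omega
    have := Nat.mul_le_mul_left (2 * (k - 2 * a - 1)) hb2
    have hk' : (T + 1) * r ≤ k - 2 * a := by omega
    rcases hQ with hQ | hQ
    · have : (T + 1) * (r - T - 2) + 1 ≤ k - 2 * a := by omega
      omega
    · rw [hQ]
      exact Nat.zero_le _
  · rw [if_neg h1]
    by_cases h2 : r + 1 ≤ a
    · rw [if_pos h2]
      rcases hQ with hQ | hQ
      · omega
      · rw [hQ]
        exact Nat.zero_le _
    · rw [if_neg h2]
      apply le_min
      · have : 0 ≤ 2 * (r - a) * (a - 2) := Nat.zero_le _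
        omega
      · have : 0 ≤ 2 * (r - a) * (a - 3) := Nat.zero_le _
        omega

/-- **THE FIRST `T` LAYERS OF THE CHERRY TABLE FOR `2 a + (T + 1) r ≤ k`** (`3 ≤ a`, `T + 1 ≤ a`, `4 T + 3 ≤ r`,
`2 r ≥ 4 T + 6 + T (T + 1)`, `r + 7 ≤ k` at `a = 3`). -/
theorem cherry_top_layers_of_k (k a r T : ℕ) (ha3 : 3 ≤ a) (ha : T + 1 ≤ a) (hr4 : 4 * T + 3 ≤ r)
    (hr : 4 * T + 6 + T * (T + 1) ≤ 2 * r) (hk : 2 * a + (T + 1) * r ≤ k) (hk3 : a = 3 → r + 7 ≤ k) :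
    (∀ (D : SimpleGraph (Fin k)) [DecidableRel D.Adj], K4mFree D → D.edgeFinset.card + r = a * (k - a) →
        D.edgeFinset.card * k < ∑ v, deg D v * deg D v + r * (k - 1 - r) + 2 * ((T + 1) * (r - T - 2)) →
        ∃ t, t ≤ T ∧ ∃ j, 2 * j ≤ t * (t + 1) ∧
          ∑ v, deg D v * deg D v + r * (k - 1 - r) + (2 * (t * (r - t - 1)) + 2 * j) = D.edgeFinset.card * k) ∧
      (∀ t, t ≤ T → ∀ j, 2 * j ≤ t * (t + 1) →
        ∃ (D : SimpleGraph (Fin k)) (_ : DecidableRel D.Adj), K4mFree D ∧ D.edgeFinset.card + r = a * (k - a) ∧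
          ∑ v, deg D v * deg D v + r * (k - 1 - r) + (2 * (t * (r - t - 1)) + 2 * j) =
            D.edgeFinset.card * k) := by
  have hr1 : r ≤ (T + 1) * r := Nat.le_mul_of_pos_left r (by omega)
  exact cherry_top_layers k a r T ha3 ha hr4 hr (by omega) hk3 (stabGapFull_ge_level k a r T ha3 hk)

/-- **THE CHERRY SPECTRUM OF THE `a`-BIPARTITE CLASS, MEMBERSHIP** (`4 T + 3 ≤ r`, `r + 1 ≤ k`): the gap of an
`a`-bipartite graph with `a (k − a) − r` edges to the closed form is a band value `2 t (r − t − 1) + 2 j` (`t ≤ T`,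
`2 j ≤ t (t + 1)`) or at least `2 (T + 1)(r − T − 2)`. -/
theorem bipSub_gap_layers_level (k a r T : ℕ) (hr4 : 4 * T + 3 ≤ r) (hk : r + 1 ≤ k) (D : SimpleGraph (Fin k))
    [DecidableRel D.Adj] (A : Finset (Fin k)) (hA : A.card = a) (hB : BipSub D A)
    (hm : D.edgeFinset.card + r = a * (k - a)) :
    (∃ t, t ≤ T ∧ ∃ j, 2 * j ≤ t * (t + 1) ∧
        ∑ v, deg D v * deg D v + r * (k - 1 - r) + (2 * (t * (r - t - 1)) + 2 * j) = D.edgeFinset.card * k) ∨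
      ∑ v, deg D v * deg D v + r * (k - 1 - r) + 2 * ((T + 1) * (r - T - 2)) ≤ D.edgeFinset.card * k := by
  have hcard : Fintype.card (Fin k) = k := Fintype.card_fin k
  have hH := bipSub_sum_deg_sq_add_disjEdgePairs D A hB a r hA (by rw [hcard]; exact hm) (by rw [hcard]; exact hk)
  rw [hcard] at hH
  have hr' : (missingGraph D A).edgeFinset.card = r := card_edges_missingGraph D A hB a r hA (by rw [hcard]; exact hm)
  have hid := sum_deg_sq_add_disjEdgePairs (missingGraph D A)
  rw [hr'] at hid
  have hfree := cliqueFree_of_bipSub _ A (bipSub_missingGraph D A)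
  rcases pair_count_spectrum_level (missingGraph D A) hfree T r hr4 hr' with ⟨t, ht, j, hj, h⟩ | h
  · left; exact ⟨t, ht, j, hj, by omega⟩
  · right; omega

/-- **THE CHERRY SPECTRUM OF THE `a`-BIPARTITE CLASS, ATTAINMENT** (`1 ≤ t`, `t + 1 ≤ a`, `2 t ≤ r`, `a + r ≤ k`,
`r + 1 ≤ k`, `2 j ≤ t (t + 1)`): an `a`-bipartite graph (`BipSub D A`, `|A| = a`) with `a (k − a) − r` edges at the
gap `2 t (r − t − 1) + 2 j`. -/
theorem bipSub_band_attained (k a r t : ℕ) (ht : 1 ≤ t) (ha : t + 1 ≤ a) (hr : 2 * t ≤ r) (hak : a + r ≤ k)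
    (hk : r + 1 ≤ k) (j : ℕ) (hj : 2 * j ≤ t * (t + 1)) :
    ∃ (D : SimpleGraph (Fin k)) (_ : DecidableRel D.Adj) (A : Finset (Fin k)), A.card = a ∧ BipSub D A ∧
      D.edgeFinset.card + r = a * (k - a) ∧
      ∑ v, deg D v * deg D v + r * (k - 1 - r) + (2 * (t * (r - t - 1)) + 2 * j) = D.edgeFinset.card * k := by
  obtain ⟨u, hu, m, hm, hjm⟩ := layer_band_full t j ht hj
  obtain ⟨-, hE, hS⟩ := layerWitness_value k a r t u m ht hu hm ha (by omega) (by omega) hak hk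
  refine ⟨layerWitness k a r t u m (by omega), inferInstance, leftPart k a, card_leftPart k a (by omega),
    bipSub_layerWitness k a r t u m (by omega), hE, ?_⟩
  rw [hjm]
  exact hS

/-- **EVERY BAND VALUE, CHERRY FORM** (`2 ≤ k`): a `K₄⁻`-free graph with `2·cherries + r (k − 1 − r) +
(2 t (r − t − 1) + 2 j) = |E| (k − 2)`. -/
theorem cherry_band_full_cherries (k a r t : ℕ) (ht : 1 ≤ t) (ha : t + 1 ≤ a) (hr : 2 * t ≤ r) (hak : a + r ≤ k)
    (hk : r + 1 ≤ k) (j : ℕ) (hj : 2 * j ≤ t * (t + 1)) :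
    ∃ (D : SimpleGraph (Fin k)) (_ : DecidableRel D.Adj), K4mFree D ∧ D.edgeFinset.card + r = a * (k - a) ∧
      2 * cherries D + r * (k - 1 - r) + (2 * (t * (r - t - 1)) + 2 * j) = D.edgeFinset.card * (k - 2) := by
  have hk2 : 2 ≤ k := by omega
  obtain ⟨D, inst, hK, hE, hS⟩ := cherry_band_full k a r t ht ha hr hak hk j hj
  refine ⟨D, inst, hK, hE, ?_⟩
  have := (gap_eq_iff_cherries k hk2 D (r * (k - 1 - r) + (2 * (t * (r - t - 1)) + 2 * j))).mp
    (by rw [← add_assoc]; exact hS)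
  rw [add_assoc]
  exact this

/-- **THE FIRST `T` LAYERS OF THE CHERRY TABLE, CHERRY FORM.** -/
theorem cherry_top_layers_cherries (k a r T : ℕ) (ha3 : 3 ≤ a) (ha : T + 1 ≤ a) (hr4 : 4 * T + 3 ≤ r)
    (hr : 4 * T + 6 + T * (T + 1) ≤ 2 * r) (hk : 2 * a + r ≤ k) (hk3 : a = 3 → r + 7 ≤ k)
    (hgap : 2 * ((T + 1) * (r - T - 2)) ≤ stabGapFull k a r) :
    (∀ (D : SimpleGraph (Fin k)) [DecidableRel D.Adj], K4mFree D → D.edgeFinset.card + r = a * (k - a) →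
        D.edgeFinset.card * (k - 2) < 2 * cherries D + r * (k - 1 - r) + 2 * ((T + 1) * (r - T - 2)) →
        ∃ t, t ≤ T ∧ ∃ j, 2 * j ≤ t * (t + 1) ∧
          2 * cherries D + r * (k - 1 - r) + (2 * (t * (r - t - 1)) + 2 * j) = D.edgeFinset.card * (k - 2)) ∧
      (∀ t, t ≤ T → ∀ j, 2 * j ≤ t * (t + 1) →
        ∃ (D : SimpleGraph (Fin k)) (_ : DecidableRel D.Adj), K4mFree D ∧ D.edgeFinset.card + r = a * (k - a) ∧
          2 * cherries D + r * (k - 1 - r) + (2 * (t * (r - t - 1)) + 2 * j) =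
            D.edgeFinset.card * (k - 2)) := by
  have hk2 : 2 ≤ k := by omega
  obtain ⟨h1, h2⟩ := cherry_top_layers k a r T ha3 ha hr4 hr hk hk3 hgap
  refine ⟨?_, ?_⟩
  · intro D _ hK hm hlt
    have hlt' : D.edgeFinset.card * k <
        ∑ v, deg D v * deg D v + r * (k - 1 - r) + 2 * ((T + 1) * (r - T - 2)) := by
      by_contra hle
      have := (gap_le_iff_cherries k hk2 D (r * (k - 1 - r) + 2 * ((T + 1) * (r - T - 2)))).mp
        (by rw [← add_assoc]; exact not_lt.mp hle)
      omega
    obtain ⟨t, ht, j, hj, h⟩ := h1 D hK hm hlt'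
    refine ⟨t, ht, j, hj, ?_⟩
    have := (gap_eq_iff_cherries k hk2 D (r * (k - 1 - r) + (2 * (t * (r - t - 1)) + 2 * j))).mp
      (by rw [← add_assoc]; exact h)
    rw [add_assoc]
    exact this
  · intro t ht j hj
    obtain ⟨D, inst, hK, hE, hS⟩ := h2 t ht j hj
    refine ⟨D, inst, hK, hE, ?_⟩
    have := (gap_eq_iff_cherries k hk2 D (r * (k - 1 - r) + (2 * (t * (r - t - 1)) + 2 * j))).mp
      (by rw [← add_assoc]; exact hS)
    rw [add_assoc]
    exact this

end C047

end TriangleCap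

end PercRepro
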